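import Summits.Ventures.Crystal3D.TopCut.TammesCertComp
import Summits.Ventures.Crystal3D.TopCut.TammesCertDataD7b1
import Summits.Ventures.Crystal3D.TopCut.TammesCertDataD7b2
import Summits.Ventures.Crystal3D.TopCut.TammesCertDataD7b3
import Summits.Ventures.Crystal3D.TopCut.TammesCertDataD7b4
import Summits.Ventures.Crystal3D.TopCut.TammesCertDataD7b5
import Summits.Ventures.Crystal3D.TopCut.TammesCertDataD7b6
import Summits.Ventures.Crystal3D.TopCut.TammesCertDataD7b7
import HarnessLib

/-!
# Kernel checks (`decide +kernel`) of the `S²` certificate D7b: `T13(arccos(257/500))`, `d = N = 7` — part B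

Computational half only (soundness is `TammesCertDefs`, the theorem is `TammesTopCut257`): validation of the
claimed expansions — `F_int` in three block chunks (`FchunkOK3`), the Gram expansions `zᵀ(LLᵀ)z` by the
ROW-CHUNKED protocol `chunkOK` (15 rows per chunk: blocks `r` 8 chunks, `r_u`/`r_v`/`r_t` 6, `r_4` 4, `q`, `q_1` 1)
— and the four checks `checkSide3`, `checkBound3`, `checkI3`, `checkII3` of `TammesCertComp`, each by kernel
`decide` (standard axioms, no `native_decide`), spread over four files `TammesCertExpandD7b{A,B,C,D}`.
Statements are written directly in terms of the raw data of `TammesCertDataD7b1`–`7` (decoded by `ofFlat`).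
Tree form of the cell `pub-crystal3d`'s farm-checked single file `TammesKernelD7b.lean` (seat p2; split for the
gate by seat typer-bulk). This part: `certD7b_ru_c1`, `certD7b_ru_c2`, `certD7b_ru_c3`, `certD7b_ru_c4`, `certD7b_ru_c5`, `certD7b_ru_c6`, `certD7b_r_c1`, `certD7b_r_c2`, `certD7b_r_c3`.

## References
* C. Bachoc, F. Vallentin, J. Amer. Math. Soc. 21 (2008), Theorem 4.2, §5. [`BachocVallentin2007`]
-/

namespace Summit.Ventures.Crystal3D.TopCut

open Literature.Geometry.DiscreteGeometry Literature.Geometry.DiscreteGeometry.PolyCert Literature.Geometry.DiscreteGeometry.PolyCert.SPoly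

open Literature.Geometry.DiscreteGeometry Literature.Geometry.DiscreteGeometry.PolyCert Literature.Geometry.DiscreteGeometry.PolyCert.SPoly
open PolyCert.SPoly TammesD7bCert

set_option maxHeartbeats 0 in
set_option maxRecDepth 100000 in
/-- block `ru`, rows 0 … 14. [folklore] -/
theorem certD7b_ru_c1 : chunkOK (GramBlk.mk z_ru L_ru) 0 15 [] (ofFlat fD1_ru_0 ++ ofFlat fD1_ru_1 ++ ofFlat fD1_ru_2) = true := by
  decide +kernel

set_option maxHeartbeats 0 in
set_option maxRecDepth 100000 in
/-- block `ru`, rows 15 … 29. [folklore] -/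
theorem certD7b_ru_c2 : chunkOK (GramBlk.mk z_ru L_ru) 15 15 (ofFlat fD1_ru_0 ++ ofFlat fD1_ru_1 ++ ofFlat fD1_ru_2) (ofFlat fD2_ru_0 ++ ofFlat fD2_ru_1 ++ ofFlat fD2_ru_2) = true := by
  decide +kernel

set_option maxHeartbeats 0 in
set_option maxRecDepth 100000 in
/-- block `ru`, rows 30 … 44. [folklore] -/
theorem certD7b_ru_c3 : chunkOK (GramBlk.mk z_ru L_ru) 30 15 (ofFlat fD2_ru_0 ++ ofFlat fD2_ru_1 ++ ofFlat fD2_ru_2) (ofFlat fD3_ru_0 ++ ofFlat fD3_ru_1 ++ ofFlat fD3_ru_2 ++ ofFlat fD3_ru_3) = true := by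
  decide +kernel

set_option maxHeartbeats 0 in
set_option maxRecDepth 100000 in
/-- block `ru`, rows 45 … 59. [folklore] -/
theorem certD7b_ru_c4 : chunkOK (GramBlk.mk z_ru L_ru) 45 15 (ofFlat fD3_ru_0 ++ ofFlat fD3_ru_1 ++ ofFlat fD3_ru_2 ++ ofFlat fD3_ru_3) (ofFlat fD4_ru_0 ++ ofFlat fD4_ru_1 ++ ofFlat fD4_ru_2 ++ ofFlat fD4_ru_3 ++ ofFlat fD4_ru_4) = true := by
  decide +kernel

set_option maxHeartbeats 0 in
set_option maxRecDepth 100000 in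
/-- block `ru`, rows 60 … 74. [folklore] -/
theorem certD7b_ru_c5 : chunkOK (GramBlk.mk z_ru L_ru) 60 15 (ofFlat fD4_ru_0 ++ ofFlat fD4_ru_1 ++ ofFlat fD4_ru_2 ++ ofFlat fD4_ru_3 ++ ofFlat fD4_ru_4) (ofFlat fD5_ru_0 ++ ofFlat fD5_ru_1 ++ ofFlat fD5_ru_2 ++ ofFlat fD5_ru_3 ++ ofFlat fD5_ru_4) = true := by
  decide +kernel

set_option maxHeartbeats 0 in
set_option maxRecDepth 100000 in
/-- block `ru`, rows 75 … 83. [folklore] -/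
theorem certD7b_ru_c6 : chunkOK (GramBlk.mk z_ru L_ru) 75 9 (ofFlat fD5_ru_0 ++ ofFlat fD5_ru_1 ++ ofFlat fD5_ru_2 ++ ofFlat fD5_ru_3 ++ ofFlat fD5_ru_4) (ofFlat fR_ru_0 ++ ofFlat fR_ru_1 ++ ofFlat fR_ru_2 ++ ofFlat fR_ru_3 ++ ofFlat fR_ru_4) = true := by
  decide +kernel

set_option maxHeartbeats 0 in
set_option maxRecDepth 100000 in
/-- block `r`, rows 0 … 14. [folklore] -/
theorem certD7b_r_c1 : chunkOK (GramBlk.mk z_r L_r) 0 15 [] (ofFlat fD1_r_0 ++ ofFlat fD1_r_1 ++ ofFlat fD1_r_2) = true := by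
  decide +kernel

set_option maxHeartbeats 0 in
set_option maxRecDepth 100000 in
/-- block `r`, rows 15 … 29. [folklore] -/
theorem certD7b_r_c2 : chunkOK (GramBlk.mk z_r L_r) 15 15 (ofFlat fD1_r_0 ++ ofFlat fD1_r_1 ++ ofFlat fD1_r_2) (ofFlat fD2_r_0 ++ ofFlat fD2_r_1 ++ ofFlat fD2_r_2 ++ ofFlat fD2_r_3) = true := by
  decide +kernel

set_option maxHeartbeats 0 in
set_option maxRecDepth 100000 in
/-- block `r`, rows 30 … 44. [folklore] -/
theorem certD7b_r_c3 : chunkOK (GramBlk.mk z_r L_r) 30 15 (ofFlat fD2_r_0 ++ ofFlat fD2_r_1 ++ ofFlat fD2_r_2 ++ ofFlat fD2_r_3) (ofFlat fD3_r_0 ++ ofFlat fD3_r_1 ++ ofFlat fD3_r_2 ++ ofFlat fD3_r_3 ++ ofFlat fD3_r_4) = true := by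
  decide +kernel

end Summit.Ventures.Crystal3D.TopCut
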